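import Literature.Barriers.PneNP.TSPExtensionComplexityMatchingsOps
import Mathlib.Data.Fintype.Card
import Mathlib.Data.Fintype.EquivFin
import Mathlib.Data.Finset.Sym
import Mathlib.Logic.Equiv.Fintype
import HarnessLib

/-!
# Perfect matchings between two vertex sets: counting by symmetry

Support file for the discharge of `Literature.Barriers.PneNP.Rothvoss2017_tsp` (Rothvoß 2017,
§3). Rothvoß's comparison of the `3`- and `k`-samples (§3.4, PDF p. 10) silently uses that the
number of perfect matchings of a vertex set, and the number of perfect matchings BETWEEN two
vertex sets, depend only on the sizes of the sets (so that conditional probabilities given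
different `3`-matchings `H` have the same normalisations). We prove these invariances by
transporting edge sets along a vertex map that is injective on the relevant set (the tree's
`IsPMOn.image`, `image_sym2Map_injOn`, `card_perfectMatchings_eq_of_card_eq` of
`…MatchingsOps.lean` do this for the perfect matchings OF a set); this file adds the bipartite
case — no closed formula (`s!`) is needed:

* `exists_map_injOn_image_eq`, `exists_map_injOn_image_eq₂` — vertex maps carrying one (two
  disjoint) set(s) onto other(s) of the same size(s);
* `bipPM A B` — the perfect matchings of `A ∪ B` all of whose edges join `A` to `B`, and
  `card_bipPM_eq_of_card_eq` — their number depends only on the sizes when the pairs are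
  disjoint.

All [folklore].
-/

namespace Literature.Barriers.PneNP

open Finset

variable {V : Type*} [DecidableEq V]

/-! ### Vertex maps between sets of equal size -/

/-- A vertex map carrying `S` bijectively onto `S'` (identity elsewhere), from `|S| = |S'|`.
[folklore] -/
theorem exists_map_injOn_image_eq {S S' : Finset V} (h : S.card = S'.card) :
    ∃ σ : V → V, Set.InjOn σ S ∧ S.image σ = S' := by
  classical
  have hc : Fintype.card S = Fintype.card S' := by simp [h]
  let e : S ≃ S' := Fintype.equivOfCardEq hc
  let σ : V → V := fun v => if hv : v ∈ S then (e ⟨v, hv⟩).1 else v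
  have hσ : ∀ v (hv : v ∈ S), σ v = (e ⟨v, hv⟩).1 := fun v hv => by simp [σ, hv]
  refine ⟨σ, fun u hu v hv huv => ?_, ?_⟩
  · rw [hσ u hu, hσ v hv] at huv
    have := e.injective (Subtype.ext huv)
    simpa using this
  · ext w
    simp only [mem_image]
    constructor
    · rintro ⟨v, hv, rfl⟩
      rw [hσ v hv]
      exact (e ⟨v, hv⟩).2
    · intro hw
      refine ⟨(e.symm ⟨w, hw⟩).1, (e.symm ⟨w, hw⟩).2, ?_⟩
      rw [hσ _ (e.symm ⟨w, hw⟩).2]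
      simp

/-! ### Perfect matchings between two vertex sets -/

/-- The **perfect matchings between `A` and `B`**: perfect matchings of `A ∪ B` every edge of
which joins a vertex of `A` to a vertex of `B` (for disjoint `A`, `B` of equal size: the
bijections `A → B`). [folklore] -/
def bipPM (A B : Finset V) : Finset (Finset (Sym2 V)) :=
  (perfectMatchings (A ∪ B)).filter fun F => ∀ e ∈ F, ∃ a ∈ A, ∃ b ∈ B, e = s(a, b)

/-- Membership in `bipPM`. [folklore] -/
theorem mem_bipPM_iff {A B : Finset V} {F : Finset (Sym2 V)} :
    F ∈ bipPM A B ↔ IsPMOn (A ∪ B) F ∧ ∀ e ∈ F, ∃ a ∈ A, ∃ b ∈ B, e = s(a, b) := by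
  simp [bipPM, mem_perfectMatchings]

/-- A vertex map carrying `A` onto `A'` and `B` onto `B'`, injective on `A ∪ B`, from
`|A| = |A'|`, `|B| = |B'|` and disjointness. [folklore] -/
theorem exists_map_injOn_image_eq₂ {A B A' B' : Finset V} (hA : A.card = A'.card)
    (hB : B.card = B'.card) (hd : Disjoint A B) (hd' : Disjoint A' B') :
    ∃ σ : V → V, Set.InjOn σ ((A ∪ B : Finset V) : Set V) ∧ A.image σ = A' ∧ B.image σ = B' := by
  classical
  obtain ⟨σA, hσA, hiA⟩ := exists_map_injOn_image_eq hA
  obtain ⟨σB, hσB, hiB⟩ := exists_map_injOn_image_eq hB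
  let σ : V → V := fun v => if v ∈ A then σA v else σB v
  have hσa : ∀ v ∈ A, σ v = σA v := fun v hv => by simp [σ, hv]
  have hσb : ∀ v ∈ B, σ v = σB v := fun v hv => by
    have : v ∉ A := disjoint_right.1 hd hv
    simp [σ, this]
  have himgA : A.image σ = A' := by
    rw [← hiA]; exact image_congr fun v hv => hσa v (mem_coe.1 hv)
  have himgB : B.image σ = B' := by
    rw [← hiB]; exact image_congr fun v hv => hσb v (mem_coe.1 hv)
  refine ⟨σ, fun u hu v hv huv => ?_, himgA, himgB⟩
  rcases mem_union.1 (mem_coe.1 hu) with hu | hu <;> rcases mem_union.1 (mem_coe.1 hv) with hv | hv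
  · rw [hσa u hu, hσa v hv] at huv
    exact hσA hu hv huv
  · exfalso
    have h1 : σ u ∈ A' := himgA ▸ mem_image_of_mem σ hu
    have h2 : σ v ∈ B' := himgB ▸ mem_image_of_mem σ hv
    exact disjoint_left.1 hd' h1 (huv ▸ h2)
  · exfalso
    have h1 : σ u ∈ B' := himgB ▸ mem_image_of_mem σ hu
    have h2 : σ v ∈ A' := himgA ▸ mem_image_of_mem σ hv
    exact disjoint_left.1 hd' h2 (huv ▸ h1)
  · rw [hσb u hu, hσb v hv] at huv
    exact hσB hu hv huv

/-- One inequality of the bipartite symmetry count. [folklore] -/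
theorem card_bipPM_le_of_card_eq {A B A' B' : Finset V} (hA : A.card = A'.card)
    (hB : B.card = B'.card) (hd : Disjoint A B) (hd' : Disjoint A' B') :
    (bipPM A B).card ≤ (bipPM A' B').card := by
  classical
  obtain ⟨σ, hσ, hiA, hiB⟩ := exists_map_injOn_image_eq₂ hA hB hd hd'
  have himg : (A ∪ B).image σ = A' ∪ B' := by rw [image_union, hiA, hiB]
  refine card_le_card_of_injOn (fun M => M.image (Sym2.map σ)) (fun M hM => ?_)
    (fun M₁ h₁ M₂ h₂ heq => ?_)
  · obtain ⟨hPM, hbip⟩ := mem_bipPM_iff.1 (mem_coe.1 hM)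
    rw [mem_coe, mem_bipPM_iff, ← himg]
    refine ⟨hPM.image σ hσ, fun e he => ?_⟩
    obtain ⟨e₀, he₀, rfl⟩ := mem_image.1 he
    obtain ⟨a, ha, b, hb, rfl⟩ := hbip e₀ he₀
    exact ⟨σ a, hiA ▸ mem_image_of_mem σ ha, σ b, hiB ▸ mem_image_of_mem σ hb, by simp⟩
  · exact image_sym2Map_injOn (A ∪ B) σ hσ
      (mem_coe.2 (mem_perfectMatchings.2 (mem_bipPM_iff.1 (mem_coe.1 h₁)).1))
      (mem_coe.2 (mem_perfectMatchings.2 (mem_bipPM_iff.1 (mem_coe.1 h₂)).1)) heq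

/-- **The number of perfect matchings between two disjoint vertex sets depends only on their
sizes.** [folklore] -/
theorem card_bipPM_eq_of_card_eq {A B A' B' : Finset V} (hA : A.card = A'.card)
    (hB : B.card = B'.card) (hd : Disjoint A B) (hd' : Disjoint A' B') :
    (bipPM A B).card = (bipPM A' B').card :=
  le_antisymm (card_bipPM_le_of_card_eq hA hB hd hd')
    (card_bipPM_le_of_card_eq hA.symm hB.symm hd' hd)

end Literature.Barriers.PneNP
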